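import Mathlib.Analysis.SpecialFunctions.Pow.Real
import Mathlib.Analysis.Complex.Polynomial.Basic
import Mathlib.Topology.Algebra.InfiniteSum.NatInt
import Mathlib.FieldTheory.IsAlgClosed.Basic
import HarnessLib

/-!
# Radial Hecke eigenfunctions at a hyperspecial vertex of a semi-homogeneous tree are never square-summable
# (the rank-one Macdonald recurrence; Macdonald 1971 Ch. V, Cartier 1979 §IV, Serre *Trees* II.1.1)

Topic `NumberTheory/Automorphic`; namespace `Literature.NumberTheory.Automorphic.RankOneRadial`.  THEOREMS ONLY (pure
Mathlib: complex sequences and `Summable`); no definition, no named fact, no instance, no notation, no `sorry`.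
Cell `hodgecm-mathlib`, fan-B row #79 (XP `Rogawski1990.XiPinSphericalCofinite`) pay-down, road (B) «local», brick (L3):
the analytic core of «a `K`-spherical irreducible representation of a `p`-adic group of relative rank one whose hyperspecial
vertex has the LARGER degree is not square-integrable modulo the centre».  HC_CM is proved only modulo the printed citations
until rung 0 closes; this file is unconditional and generic.

## The mathematics

Let `X` be the semi-homogeneous (biregular) tree with vertex degrees `a + 1` (class `o`) and `b + 1` (the other class),
`a, b ≥ 1` — for the unramified quasi-split unitary group `U(3)(E_w/F_v)` this is the Bruhat–Tits tree with `a = q³`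
at the hyperspecial vertices and `b = q` at the others ([Tits1979] §2.10, §3.3.3; [BruhatTits1972] (4.4.3)–(4.4.4)); for
`SL₂`/`PGL₂`/`U(2)` it is homogeneous, `a = b = q` ([SerreTrees1980] II.1.1).  The radius-`1` Hecke operator `T` on
functions on the class-`o` vertices sums over the `(a+1)b` class-`o` vertices at distance `2`; from a vertex at radius
`n ≥ 1` (distance `2n` from `o`) these are `ab` vertices at radius `n+1`, `b-1` at radius `n` and `1` at radius `n-1`.
Hence a RADIAL `T`-eigenfunction `ω` (`Tω = λω`, `ω_n` its value at radius `n`) satisfies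

  `λ ω₀ = (a+1)b · ω₁`,   `λ ω_n = ab · ω_{n+1} + (b-1) · ω_n + ω_{n-1}`  (`n ≥ 1`),        (R)

equivalently, with the sphere sizes `d₀ = 1`, `d_n = (a+1)b(ab)^{n-1}` and `s_n := d_n ω_n`:
`s₁ = λ`, `s₂ = (λ-b+1)λ - (a+1)b`, `s_{n+1} = (λ-b+1)s_n - ab·s_{n-1}` (`n ≥ 2`) — the rank-one case of Macdonald's
recurrence for zonal spherical functions ([Macdonald1971] Ch. V; [CartierCorvallis1979] §IV Thm. 4.1–4.2, where `s_n` is the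
Hecke eigenvalue of `𝟙_{K tⁿ K}`).  **Theorem** (`not_summable_norm_sq_div_pow`, `not_summable_norm_sq_mul_pow`,
`not_summable_norm_sq_mul_sphere`): if `b ≤ a` and `ab ≥ 2`, then for EVERY `λ ∈ ℂ` and every solution with `ω₀ = 1`,
`Σ_n |ω_n|² d_n = ∞`, i.e. `ω ∉ ℓ²(X_o)` — no `K`-spherical matrix coefficient is square-integrable.  Proof (no explicit
root asymptotics): with `r₁ + r₂ = λ - b + 1`, `r₁r₂ = ab`, `|r₂| ≤ |r₁|`, the sequence `u_m = s_{m+2} - r₂ s_{m+1}` is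
geometric of ratio `r₁`, `|r₁|² ≥ ab`, so square-summability forces `u₀ = 0`; but `u₀ = (r₁ + b)(r₁ - 1)` identically, and
then `s_{m+1} = r₂^m s₁` forces either `s₁ = s₂ = 0` (contradicting `s₂ = -(a+1)b` when `λ = s₁ = 0`) or `|r₂|² < ab < |r₁|²`
with `r₁ ∈ {1, -b}`, contradicting `|r₁|² > ab ≥ max(1, b²)`.  The hypothesis `b ≤ a` is SHARP: on the other vertex class of the
`U(3)` tree (`a = q`, `b = q³`) the solution with `r₁ = -b` IS square-summable at `λ = -(q³+1)` — the vector of the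
square-integrable Keys constituent `π²(ξ_v)` fixed by the non-hyperspecial maximal compact subgroup ([Marshall2014] §3.3).

## What is formalised
* `geometric_defect` — `u_{m+1} = r₁ u_m` for `u_m = s_{m+2} - r₂ s_{m+1}`.
* `defect_zero_eq` — `s₂ - r₂ s₁ = (r₁ + b)(r₁ - 1)`.
* **`not_summable_norm_sq_div_pow`** (the `s`-normalisation), **`not_summable_norm_sq_mul_pow`** (the `ω`-normalisation (R),
  weight `(ab)ⁿ`), **`not_summable_norm_sq_mul_sphere`** (weight the sphere sizes `d_n`).
-/

noncomputable section

open Filter Topology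

namespace Literature.NumberTheory.Automorphic.RankOneRadial

/-- The DEFECT sequence `u_m = s_{m+2} - r₂ s_{m+1}` of a solution of `s_{n+1} = (r₁+r₂) s_n - r₁r₂ s_{n-1}` (`n ≥ 2`) is
geometric of ratio `r₁`: `u_{m+1} = r₁ u_m`. [cite: Macdonald1971, Ch. V §1] -/
theorem geometric_defect {c P r₁ r₂ : ℂ} {s : ℕ → ℂ} (hsum : r₁ + r₂ = c) (hprod : r₁ * r₂ = P)
    (hrec : ∀ n, 2 ≤ n → s (n + 1) = c * s n - P * s (n - 1)) (m : ℕ) :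
    s (m + 3) - r₂ * s (m + 2) = r₁ * (s (m + 2) - r₂ * s (m + 1)) := by
  have h := hrec (m + 2) (by omega)
  have h' : s (m + 3) = c * s (m + 2) - P * s (m + 1) := by
    simpa [show m + 2 + 1 = m + 3 by omega, show m + 2 - 1 = m + 1 by omega] using h
  rw [h', ← hsum, ← hprod]
  ring

/-- Closed form of the defect: `u_m = r₁^m · u₀`. [cite: Macdonald1971, Ch. V §1] -/
theorem defect_eq_pow_mul {c P r₁ r₂ : ℂ} {s : ℕ → ℂ} (hsum : r₁ + r₂ = c) (hprod : r₁ * r₂ = P)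
    (hrec : ∀ n, 2 ≤ n → s (n + 1) = c * s n - P * s (n - 1)) (m : ℕ) :
    s (m + 2) - r₂ * s (m + 1) = r₁ ^ m * (s 2 - r₂ * s 1) := by
  induction m with
  | zero => simp
  | succ m ih =>
    rw [show m + 1 + 2 = m + 3 by omega, show m + 1 + 1 = m + 2 by omega,
      geometric_defect hsum hprod hrec m, ih, pow_succ]
    ring

/-- The INITIAL defect of the hyperspecial radial recurrence is independent of the solution:
`s₂ - r₂ s₁ = (r₁ + b)(r₁ - 1)` when `s₁ = λ`, `s₂ = (λ-b+1)λ - (a+1)b`, `r₁ + r₂ = λ - b + 1`, `r₁r₂ = ab`.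
[cite: Macdonald1971, Ch. V §3] -/
theorem defect_zero_eq {a b lam r₁ r₂ : ℂ} {s : ℕ → ℂ} (h1 : s 1 = lam) (h2 : s 2 = (lam - b + 1) * lam - (a + 1) * b)
    (hsum : r₁ + r₂ = lam - b + 1) (hprod : r₁ * r₂ = a * b) :
    s 2 - r₂ * s 1 = (r₁ + b) * (r₁ - 1) := by
  rw [h2, h1]
  have hlam : lam = r₁ + r₂ + b - 1 := by rw [hsum]; ring
  rw [hlam]
  linear_combination hprod

/-- If a nonnegative real sequence tends to `0` and is bounded below by a constant `C`, then `C ≤ 0`. [folklore] -/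
private theorem const_le_zero_of_tendsto {f : ℕ → ℝ} {C : ℝ} (hf : Tendsto f atTop (𝓝 0)) (hC : ∀ n, C ≤ f n) : C ≤ 0 :=
  ge_of_tendsto hf (Eventually.of_forall hC)

/-- **No square-summable solution (the `s`-normalisation).**  Let `a ≥ b` be naturals with `ab ≥ 2`, `λ ∈ ℂ`, and
`s : ℕ → ℂ` with `s₁ = λ`, `s₂ = (λ-b+1)λ - (a+1)b`, `s_{n+1} = (λ-b+1) s_n - ab · s_{n-1}` for `n ≥ 2` (the Hecke eigenvalues
`s_n` of `𝟙_{K tⁿ K}` on a `K`-spherical line, `K` hyperspecial of the larger degree `a+1`).  Then `Σ_n |s_n|² (ab)^{-n}`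
DIVERGES. [cite: Macdonald1971, Ch. V §3] [cite: CartierCorvallis1979, §IV Thm. 4.2] -/
theorem not_summable_norm_sq_div_pow {a b : ℕ} (hba : b ≤ a) (hab : 2 ≤ a * b) {lam : ℂ} {s : ℕ → ℂ}
    (h1 : s 1 = lam) (h2 : s 2 = (lam - b + 1) * lam - (a + 1) * b)
    (hrec : ∀ n, 2 ≤ n → s (n + 1) = (lam - b + 1) * s n - a * b * s (n - 1)) :
    ¬ Summable (fun n : ℕ => ‖s n‖ ^ 2 / ((a : ℝ) * b) ^ n) := by
  intro hS
  -- the real parameter `P = ab ≥ 2`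
  set P : ℝ := (a : ℝ) * b with hPdef
  have hP2 : (2 : ℝ) ≤ P := by
    have : ((2 : ℕ) : ℝ) ≤ ((a * b : ℕ) : ℝ) := Nat.cast_le.2 hab
    simpa [hPdef] using this
  have hP0 : 0 < P := by linarith
  have hbP : (b : ℝ) ^ 2 ≤ P := by
    have : (b : ℝ) ≤ a := Nat.cast_le.2 hba
    rw [hPdef, pow_two]; exact mul_le_mul_of_nonneg_right this (by positivity)
  -- decay of the terms
  have hD : Tendsto (fun n : ℕ => ‖s n‖ ^ 2 / P ^ n) atTop (𝓝 0) := hS.tendsto_atTop_zero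
  -- a square root of the discriminant of `X² - cX + ab`, `c = λ - b + 1`
  obtain ⟨δ, hδ⟩ := IsAlgClosed.exists_pow_nat_eq ((lam - b + 1) ^ 2 - 4 * ((a : ℂ) * b)) two_pos
  have hnormP : ‖((a : ℂ) * b)‖ = P := by
    rw [norm_mul, Complex.norm_natCast, Complex.norm_natCast]
  -- the symmetric core: an ordered pair of roots gives a contradiction
  have key : ∀ r₁ r₂ : ℂ, r₁ + r₂ = lam - b + 1 → r₁ * r₂ = (a : ℂ) * b → ‖r₂‖ ≤ ‖r₁‖ → False := by
    intro r₁ r₂ hsum hprod hle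
    have hnorm : ‖r₁‖ * ‖r₂‖ = P := by rw [← norm_mul, hprod, hnormP]
    have hr1 : P ≤ ‖r₁‖ ^ 2 := by
      rw [pow_two, ← hnorm]; exact mul_le_mul_of_nonneg_left hle (norm_nonneg _)
    have hrec' : ∀ n, 2 ≤ n → s (n + 1) = (lam - b + 1) * s n - ((a : ℂ) * b) * s (n - 1) := fun n hn => by
      rw [hrec n hn]
    -- the defect `u_m = s_{m+2} - r₂ s_{m+1} = r₁^m u₀`, `u₀ = (r₁ + b)(r₁ - 1)`
    have hu : ∀ m, s (m + 2) - r₂ * s (m + 1) = r₁ ^ m * (s 2 - r₂ * s 1) :=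
      defect_eq_pow_mul hsum hprod hrec'
    have hu0 : s 2 - r₂ * s 1 = (r₁ + b) * (r₁ - 1) := defect_zero_eq h1 h2 hsum hprod
    -- decay of the defect: `‖u_m‖² / P^(m+2) → 0`
    have hdu : Tendsto (fun m : ℕ => ‖s (m + 2) - r₂ * s (m + 1)‖ ^ 2 / P ^ (m + 2)) atTop (𝓝 0) := by
      have h2' : Tendsto (fun m : ℕ => ‖s (m + 2)‖ ^ 2 / P ^ (m + 2)) atTop (𝓝 0) :=
        hD.comp (tendsto_add_atTop_nat 2)
      have h1' : Tendsto (fun m : ℕ => ‖s (m + 1)‖ ^ 2 / P ^ (m + 1)) atTop (𝓝 0) :=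
        hD.comp (tendsto_add_atTop_nat 1)
      have hlim : Tendsto (fun m : ℕ => 2 * (‖s (m + 2)‖ ^ 2 / P ^ (m + 2)) +
          2 * ‖r₂‖ ^ 2 / P * (‖s (m + 1)‖ ^ 2 / P ^ (m + 1))) atTop (𝓝 0) := by
        simpa using (h2'.const_mul 2).add (h1'.const_mul (2 * ‖r₂‖ ^ 2 / P))
      refine squeeze_zero (fun m => by positivity) (fun m => ?_) hlim
      have hx : ‖s (m + 2) - r₂ * s (m + 1)‖ ≤ ‖s (m + 2)‖ + ‖r₂‖ * ‖s (m + 1)‖ := by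
        calc ‖s (m + 2) - r₂ * s (m + 1)‖ ≤ ‖s (m + 2)‖ + ‖r₂ * s (m + 1)‖ := norm_sub_le _ _
          _ = ‖s (m + 2)‖ + ‖r₂‖ * ‖s (m + 1)‖ := by rw [norm_mul]
      have hsq : ‖s (m + 2) - r₂ * s (m + 1)‖ ^ 2 ≤
          2 * ‖s (m + 2)‖ ^ 2 + 2 * (‖r₂‖ ^ 2 * ‖s (m + 1)‖ ^ 2) := by
        have h0 : 0 ≤ ‖s (m + 2) - r₂ * s (m + 1)‖ := norm_nonneg _
        nlinarith [hx, h0, sq_nonneg (‖s (m + 2)‖ - ‖r₂‖ * ‖s (m + 1)‖), norm_nonneg r₂,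
          norm_nonneg (s (m + 1)), norm_nonneg (s (m + 2))]
      calc ‖s (m + 2) - r₂ * s (m + 1)‖ ^ 2 / P ^ (m + 2)
          ≤ (2 * ‖s (m + 2)‖ ^ 2 + 2 * (‖r₂‖ ^ 2 * ‖s (m + 1)‖ ^ 2)) / P ^ (m + 2) :=
            div_le_div_of_nonneg_right hsq (pow_pos hP0 _).le
        _ = 2 * (‖s (m + 2)‖ ^ 2 / P ^ (m + 2)) + 2 * ‖r₂‖ ^ 2 / P * (‖s (m + 1)‖ ^ 2 / P ^ (m + 1)) := by
            rw [show P ^ (m + 2) = P ^ (m + 1) * P by ring]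
            field_simp
    -- lower bound of the defect: `‖u₀‖² / P² ≤ ‖u_m‖² / P^(m+2)`
    have hlow : ∀ m, ‖s 2 - r₂ * s 1‖ ^ 2 / P ^ 2 ≤ ‖s (m + 2) - r₂ * s (m + 1)‖ ^ 2 / P ^ (m + 2) := by
      intro m
      have hnm : ‖r₁ ^ m * (s 2 - r₂ * s 1)‖ ^ 2 = (‖r₁‖ ^ 2) ^ m * ‖s 2 - r₂ * s 1‖ ^ 2 := by
        rw [norm_mul, norm_pow, mul_pow, pow_right_comm]
      have hpow : P ^ m ≤ (‖r₁‖ ^ 2) ^ m := pow_le_pow_left₀ hP0.le hr1 m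
      rw [hu m, hnm, div_le_div_iff₀ (pow_pos hP0 2) (pow_pos hP0 (m + 2))]
      calc ‖s 2 - r₂ * s 1‖ ^ 2 * P ^ (m + 2) = P ^ m * (‖s 2 - r₂ * s 1‖ ^ 2 * P ^ 2) := by ring
        _ ≤ (‖r₁‖ ^ 2) ^ m * (‖s 2 - r₂ * s 1‖ ^ 2 * P ^ 2) :=
            mul_le_mul_of_nonneg_right hpow (by positivity)
        _ = (‖r₁‖ ^ 2) ^ m * ‖s 2 - r₂ * s 1‖ ^ 2 * P ^ 2 := by ring
    have hu00 : s 2 - r₂ * s 1 = 0 := by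
      have h := const_le_zero_of_tendsto hdu hlow
      have h' : ‖s 2 - r₂ * s 1‖ ^ 2 ≤ 0 := by
        rwa [div_le_iff₀ (pow_pos hP0 2), zero_mul] at h
      exact norm_eq_zero.1 (by nlinarith [norm_nonneg (s 2 - r₂ * s 1)])
    -- hence `s_{m+1} = r₂^m s₁`
    have hs : ∀ m, s (m + 1) = r₂ ^ m * s 1 := by
      intro m
      induction m with
      | zero => simp
      | succ m ih =>
        have h := hu m
        rw [hu00, mul_zero, sub_eq_zero] at h
        rw [show m + 1 + 1 = m + 2 by omega, h, ih, pow_succ]; ring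
    rcases lt_or_ge (‖r₂‖ ^ 2) P with hlt | hge
    · -- `|r₂|² < ab < |r₁|²` and `r₁ ∈ {1, -b}`: impossible
      have hr1' : P < ‖r₁‖ ^ 2 := by
        by_contra hcon
        rw [not_lt] at hcon
        have hP2sq : P ^ 2 = ‖r₁‖ ^ 2 * ‖r₂‖ ^ 2 := by rw [← mul_pow, hnorm]
        have : ‖r₁‖ ^ 2 * ‖r₂‖ ^ 2 < P * P := by
          calc ‖r₁‖ ^ 2 * ‖r₂‖ ^ 2 ≤ P * ‖r₂‖ ^ 2 := mul_le_mul_of_nonneg_right hcon (by positivity)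
            _ < P * P := mul_lt_mul_of_pos_left hlt hP0
        nlinarith [hP2sq, this]
      rw [hu0] at hu00
      rcases mul_eq_zero.1 hu00 with h | h
      · have : r₁ = -(b : ℂ) := eq_neg_of_add_eq_zero_left h
        rw [this, norm_neg, Complex.norm_natCast] at hr1'
        linarith
      · have : r₁ = 1 := sub_eq_zero.1 h
        rw [this, norm_one, one_pow] at hr1'
        linarith
    · -- `|r₂|² ≥ ab`: then `s₁ = 0`, so `λ = 0` and `s₂ = -(a+1)b ≠ 0 = r₂ s₁`
      have hlow' : ∀ m, ‖s 1‖ ^ 2 / P ≤ ‖s (m + 1)‖ ^ 2 / P ^ (m + 1) := by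
        intro m
        have hnm : ‖r₂ ^ m * s 1‖ ^ 2 = (‖r₂‖ ^ 2) ^ m * ‖s 1‖ ^ 2 := by
          rw [norm_mul, norm_pow, mul_pow, pow_right_comm]
        have hpow : P ^ m ≤ (‖r₂‖ ^ 2) ^ m := pow_le_pow_left₀ hP0.le hge m
        rw [hs m, hnm, div_le_div_iff₀ hP0 (pow_pos hP0 (m + 1))]
        calc ‖s 1‖ ^ 2 * P ^ (m + 1) = P ^ m * (‖s 1‖ ^ 2 * P) := by ring
          _ ≤ (‖r₂‖ ^ 2) ^ m * (‖s 1‖ ^ 2 * P) := mul_le_mul_of_nonneg_right hpow (by positivity)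
          _ = (‖r₂‖ ^ 2) ^ m * ‖s 1‖ ^ 2 * P := by ring
      have hs1 : s 1 = 0 := by
        have h := const_le_zero_of_tendsto (hD.comp (tendsto_add_atTop_nat 1)) hlow'
        have h' : ‖s 1‖ ^ 2 ≤ 0 := by rwa [div_le_iff₀ hP0, zero_mul] at h
        exact norm_eq_zero.1 (by nlinarith [norm_nonneg (s 1)])
      have hlam0 : lam = 0 := by rw [← h1, hs1]
      have hs2 : s 2 = 0 := by rw [hs 1, hs1, mul_zero]
      rw [h2, hlam0] at hs2
      have hb0 : (b : ℂ) ≠ 0 := by exact_mod_cast (show b ≠ 0 by rintro rfl; simp at hab)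
      have ha0 : ((a : ℂ) + 1) ≠ 0 := by exact_mod_cast (Nat.succ_ne_zero a)
      exact mul_ne_zero ha0 hb0 (by simpa using hs2)
  -- instantiate the core at the ordered pair of roots `((c ± δ)/2)`
  have hsum : (lam - b + 1 + δ) / 2 + (lam - b + 1 - δ) / 2 = lam - b + 1 := by ring
  have hprod : (lam - b + 1 + δ) / 2 * ((lam - b + 1 - δ) / 2) = (a : ℂ) * b := by
    have : (lam - b + 1 + δ) / 2 * ((lam - b + 1 - δ) / 2) = ((lam - b + 1) ^ 2 - δ ^ 2) / 4 := by ring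
    rw [this, hδ]; ring
  rcases le_total ‖(lam - b + 1 - δ) / 2‖ ‖(lam - b + 1 + δ) / 2‖ with h | h
  · exact key _ _ hsum hprod h
  · exact key _ _ (by rw [add_comm, hsum]) (by rw [mul_comm, hprod]) h

/-- Positivity of the tree parameter: `ab ≥ 2 ⇒ 0 < ab` in `ℝ`. [folklore] -/
private theorem cast_mul_pos {a b : ℕ} (hab : 2 ≤ a * b) : (0 : ℝ) < (a : ℝ) * b := by
  have : ((2 : ℕ) : ℝ) ≤ ((a * b : ℕ) : ℝ) := Nat.cast_le.2 hab
  push_cast at this; linarith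

/-- **No square-summable radial eigenfunction (the `ω`-normalisation (R)).**  With `a ≥ b`, `ab ≥ 2`: a sequence `ω : ℕ → ℂ`
with `ω₀ = 1`, `λ = (a+1)b ω₁` (i.e. `λ ω₀ = (a+1)b ω₁`) and `λ ω_n = ab ω_{n+1} + (b-1) ω_n + ω_{n-1}` (`n ≥ 1`) — a radial
eigenfunction of the radius-one Hecke operator seen from a hyperspecial vertex of the larger degree — has
`Σ_n |ω_n|² (ab)ⁿ = ∞`. [cite: Macdonald1971, Ch. V §3] [cite: CartierCorvallis1979, §IV Thm. 4.2] -/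
theorem not_summable_norm_sq_mul_pow {a b : ℕ} (hba : b ≤ a) (hab : 2 ≤ a * b) {lam : ℂ} {ω : ℕ → ℂ}
    (h0 : ω 0 = 1) (h1 : lam = (a + 1) * b * ω 1)
    (hrec : ∀ n, 1 ≤ n → lam * ω n = a * b * ω (n + 1) + (b - 1) * ω n + ω (n - 1)) :
    ¬ Summable (fun n : ℕ => ‖ω n‖ ^ 2 * ((a : ℝ) * b) ^ n) := by
  intro hS
  -- `s_n = (a+1) b (ab)^{n-1} ω_n` for `n ≥ 1`
  set s : ℕ → ℂ := fun n => ((a : ℂ) + 1) * b * ((a : ℂ) * b) ^ (n - 1) * ω n with hsdef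
  have hs1 : s 1 = lam := by
    simp only [hsdef, show (1 : ℕ) - 1 = 0 from rfl, pow_zero, mul_one, h1]
  have hs2 : s 2 = (lam - b + 1) * lam - (a + 1) * b := by
    have h := hrec 1 le_rfl
    simp only [show (1 : ℕ) + 1 = 2 from rfl, show (1 : ℕ) - 1 = 0 from rfl, h0] at h
    simp only [hsdef, show (2 : ℕ) - 1 = 1 from rfl, pow_one]
    rw [h1] at h ⊢
    linear_combination (-(((a : ℂ) + 1) * b)) * h
  have hsrec : ∀ n, 2 ≤ n → s (n + 1) = (lam - b + 1) * s n - a * b * s (n - 1) := by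
    intro n hn
    obtain ⟨k, rfl⟩ : ∃ k, n = k + 2 := ⟨n - 2, by omega⟩
    have h := hrec (k + 2) (by omega)
    simp only [show k + 2 + 1 = k + 3 by omega, show k + 2 - 1 = k + 1 by omega] at h ⊢
    simp only [hsdef, show k + 3 - 1 = k + 2 by omega, show k + 2 - 1 = k + 1 by omega,
      show k + 1 - 1 = k by omega]
    linear_combination (-(((a : ℂ) + 1) * b * ((a : ℂ) * b) ^ (k + 1))) * h
  refine not_summable_norm_sq_div_pow hba hab hs1 hs2 hsrec ?_
  -- compare the two weights on `n ≥ 1`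
  have hP0 : (0 : ℝ) < (a : ℝ) * b := cast_mul_pos hab
  have hn : ‖((a : ℂ) + 1)‖ = (a : ℝ) + 1 := by
    have := Complex.norm_natCast (a + 1)
    push_cast at this
    exact this
  have hshift : Summable (fun n : ℕ => ‖ω (n + 1)‖ ^ 2 * ((a : ℝ) * b) ^ (n + 1)) :=
    (summable_nat_add_iff 1).2 hS
  have ha0 : (a : ℝ) ≠ 0 := fun h => by rw [h, zero_mul] at hP0; exact lt_irrefl _ hP0
  have hb0 : (b : ℝ) ≠ 0 := fun h => by rw [h, mul_zero] at hP0; exact lt_irrefl _ hP0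
  have hshift' : Summable (fun n : ℕ => ‖s (n + 1)‖ ^ 2 / ((a : ℝ) * b) ^ (n + 1)) := by
    refine (hshift.mul_left ((((a : ℝ) + 1) * b) ^ 2 / ((a : ℝ) * b) ^ 2)).congr (fun n => ?_)
    simp only [hsdef, show n + 1 - 1 = n by omega, norm_mul, norm_pow, Complex.norm_natCast, hn]
    field_simp
    ring
  exact (summable_nat_add_iff 1).1 hshift'

/-- **No square-summable radial eigenfunction, weighted by the sphere sizes** `d₀ = 1`, `d_n = (a+1)b(ab)^{n-1}` (the number
of class-`o` vertices at radius `n`, i.e. `#(K tⁿ K / K)`): `Σ_n |ω_n|² d_n = ∞` under the hypotheses of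
`not_summable_norm_sq_mul_pow`. [cite: Macdonald1971, Ch. V §3] [cite: SerreTrees1980, II.1.1] -/
theorem not_summable_norm_sq_mul_sphere {a b : ℕ} (hba : b ≤ a) (hab : 2 ≤ a * b) {lam : ℂ} {ω : ℕ → ℂ}
    (h0 : ω 0 = 1) (h1 : lam = (a + 1) * b * ω 1)
    (hrec : ∀ n, 1 ≤ n → lam * ω n = a * b * ω (n + 1) + (b - 1) * ω n + ω (n - 1)) :
    ¬ Summable (fun n : ℕ =>
      ‖ω n‖ ^ 2 * (if n = 0 then (1 : ℝ) else ((a : ℝ) + 1) * b * ((a : ℝ) * b) ^ (n - 1))) := by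
  intro hS
  refine not_summable_norm_sq_mul_pow hba hab h0 h1 hrec ?_
  have hP0 : (0 : ℝ) < (a : ℝ) * b := cast_mul_pos hab
  have ha0 : (0 : ℝ) < (a : ℝ) + 1 := by positivity
  have hshift : Summable (fun n : ℕ => ‖ω (n + 1)‖ ^ 2 *
      (if n + 1 = 0 then (1 : ℝ) else ((a : ℝ) + 1) * b * ((a : ℝ) * b) ^ (n + 1 - 1))) :=
    (summable_nat_add_iff 1).2 hS
  have hshift' : Summable (fun n : ℕ => ‖ω (n + 1)‖ ^ 2 * ((a : ℝ) * b) ^ (n + 1)) := by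
    refine (hshift.mul_left ((a : ℝ) / ((a : ℝ) + 1))).congr (fun n => ?_)
    simp only [Nat.succ_ne_zero, if_false, show n + 1 - 1 = n by omega]
    rw [pow_succ]
    field_simp
    ring
  exact (summable_nat_add_iff 1).1 hshift'

end Literature.NumberTheory.Automorphic.RankOneRadial

end
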